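import Mathlib
import HarnessLib
import Summits.ResolutionOfSingularities.ResolutionOfSingularities.Theorems.WildQuotientsWildQuotientResolutionS1aInducedTorus
import Summits.ResolutionOfSingularities.ResolutionOfSingularities.Theorems.WildQuotientsWildQuotientResolutionS1aTameBRExitCover

/-!
# Line B `s1a-tamebr` after (S1)+(S2)+(S3): `TameBRExitCover` and `stub_tameToBR` UNCONDITIONALLY
(crux stmt-ResolutionOfSingularities-17941 `WildQuotients.CyclicQuotientFourfolds`, line B `s1a-tamebr` — published
`Cruxes/CyclicQuotientFourfolds/Lines/s1a_tamebr.lean`, NOT registered (conditional twin of line L); plan-1 DECONFLICT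
2026-08-27T21:08:02Z. [OURS · L1 W4.5c] — NOT statements of the manuscript; counted 0. Filer res-L1-w45c-stub-4 (gen 5).
Support theorems on 17941, not stub closures.)

* `S1.TameToBR.tameBRExitCover_holds : TameBRExitCover` — tame root charts of a `k`-scheme locally of finite type over a
  perfect field carry a Bergh–Rydh exit cover: (S1) `inducedTorus_holds` (p571303) fed into (S2)+(S3)
  `tameBRExitCover_of_inducedTorus` (`…S1aTameBRExitCover`);
* **`S1.stub_tameToBR : ∀ p, p.Prime → S1.GlobalKillTame p → S1.GlobalKillBR p`** — line B's skeleton stub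
  `stub_tameToBR` with its signature verbatim, now a theorem (`stub_tameToBR_of_inducedTorus inducedTorus_holds`).
After this file, line B's `CyclicQuotientFourfolds_of` rests on `stub_minVertexTame` (the S1a local game + (T2)) and the
named fact `stub_berghRydh` (`BerghRydh2019_diagonalizableQuotientResolution`) only.
-/

set_option linter.dupNamespace false

namespace Summit.ResolutionOfSingularities.ResolutionOfSingularities.Theorems.WildQuotientResolution.S1

/-- **Tame root charts carry a Bergh–Rydh exit cover** (`S1.TameToBR.TameBRExitCover`, unconditionally):
(S1) induced torus + (S2) Zariski–Luna slice + (S3) chart bookkeeping. [OURS · L1 W4.5c] -/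
theorem TameToBR.tameBRExitCover_holds : TameToBR.TameBRExitCover :=
  TameToBR.tameBRExitCover_of_inducedTorus TameToBR.inducedTorus_holds

/-- **`stub_tameToBR` of line B `s1a-tamebr`, PROVED** (signature verbatim: `∀ p, p.Prime → S1.GlobalKillTame p →
S1.GlobalKillBR p`): a KILL-TAME model is a KILL-BR model, by `tameBRExitCover_holds`. [OURS · L1 W4.5c] -/
theorem stub_tameToBR : ∀ p : ℕ, p.Prime → GlobalKillTame p → GlobalKillBR p :=
  TameToBR.stub_tameToBR_of_inducedTorus TameToBR.inducedTorus_holds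

end Summit.ResolutionOfSingularities.ResolutionOfSingularities.Theorems.WildQuotientResolution.S1
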